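import Summits.FinalStateConjecture.FinalStateConjecture.Theorems.PhotonSphereChannelsWindowedShellChannelsStubParity
import Summits.FinalStateConjecture.FinalStateConjecture.Theorems.PhotonSphereChannelsWindowedShellChannelsNearFarSplit
import Summits.FinalStateConjecture.FinalStateConjecture.Theorems.PhotonSphereChannelsWindowedShellChannelsStubNearHalfShare
import Literature.Analysis.Calculus.CutoffDataEnergy

/-!
# Crux `WindowedShellChannels` (stmt-FinalStateConjecture-14085), line `Sketch` — stub `stub_dyadicSplit`
# (piece S3 of the per-mode line: the large-scale split with `(1+δ)` energy control)

For `ρ ≤ R₀` and `δ > 0` there is `R₁ ≥ R₀` (explicit: `R₁ = R₀·exp Λ`,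
`Λ = 1 + 2C + 8C²(1 + 2/δ₀)/δ₀`, `δ₀ = min δ 1`, `C` the absolute constant of the logarithmic-scale
cutoffs) such that every finite-energy parity-`σ` unit-mass Regge–Wheeler solution of the mode `(s, ℓ)`
along the centred tortoise line whose Cauchy data vanish on the shell `{|x| ≤ ρ}` splits as
`ψ = ψc + (ψn + ψf)` into three solutions of the same parity with data supported in `[−R₁, R₁]`,
`(−∞, −R₀)`, `(R₀, ∞)`, with `E(ψc) ≤ 4E(ψ)` and `E(ψn) + E(ψf) ≤ (1+δ)E(ψ)`.

Proof.  Instead of pigeonholing one dyadic layer we cut ONCE with a logarithmic-scale cutoff `χ`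
(`Literature.Analysis.Calculus.exists_logScaleCutoff`: `χ = 1` on `{|x| ≤ R₀}`, `χ = 0` on
`{|x| ≥ R₁}`, `|χ′| ≤ C/(Λ|x|)`), whose cost `∫χ′²h² ≤ 4(C/Λ)²∫h′²` is small by the two-sided Hardy
bound for data vanishing on the shell (`Literature.Analysis.Calculus.lintegral_cutData_le`,
`lintegral_tailData_le`).  The compact data `(χh, χg)` and the two halves of the tail data
`((1−χ)h, (1−χ)g)` (cut at `x = 0`, where they vanish: `WindowedShellChannelsSplit.contDiff_cut`) are
evolved by `CauchyWaveGlobal.stub_rwGlobalCauchy` and symmetrised in time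
(`WindowedShellChannelsStubs.Parity.isSolution_comb` with coefficients `(½, σ/2)`), which enforces the
parity, keeps the supports, does not increase the energy, and reproduces `ψ` by uniqueness because a
parity-`σ` solution with `σ² = 1` has data `((1+σ)/2·h, (1−σ)/2·g) = (h, g)`; for `σ² ≠ 1` the
solution vanishes.  No definitions. [folklore in method; new]
-/

noncomputable section

set_option linter.dupNamespace false

namespace Summit.FinalStateConjecture.FinalStateConjecture.Theorems.WindowedShellChannelsSketch

open Literature.Geometry.Lorentzian Literature.Geometry.Lorentzian.ReggeWheeler Filter Set MeasureTheory
open Literature.Analysis.PDE Literature.Analysis.Calculus Real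
open Summit.FinalStateConjecture.FinalStateConjecture.Theorems.CauchyWaveGlobal
open Summit.FinalStateConjecture.FinalStateConjecture.Theorems.WindowedShellChannelsStubs
open scoped ENNReal Topology

namespace DyadicSplit

variable {V : ℝ → ℝ} {φ : ℝ → ℝ → ℝ} {σ : ℝ}

/-- For `σ² = 1` the symmetrisation coefficients `((1±σ)/2)²` are at most `1`. [folklore] -/
theorem coef_sq_le_one (hσ : σ ^ 2 = 1) :
    (2⁻¹ + σ * 2⁻¹) ^ 2 ≤ 1 ∧ (2⁻¹ - σ * 2⁻¹) ^ 2 ≤ 1 := by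
  constructor <;> nlinarith [sq_nonneg (σ - 1), sq_nonneg (σ + 1)]

/-- **The symmetrised piece is parity-pure**: `P(−t) = σP(t)` for `P = ½φ(t) + (σ/2)φ(−t)`, `σ² = 1`.
[folklore] -/
theorem comb_parity (hσ : σ ^ 2 = 1) (t x : ℝ) :
    (fun t x => 2⁻¹ * φ t x + σ * 2⁻¹ * φ (-t) x) (-t) x
      = σ * (fun t x => 2⁻¹ * φ t x + σ * 2⁻¹ * φ (-t) x) t x := by
  simp only [neg_neg]
  linear_combination (-(2⁻¹ * φ (-t) x)) * hσ

/-- **The symmetrised piece costs no energy at `t = 0`**: if `φ` has Cauchy data `(A, B)` then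
`e[½φ + (σ/2)φ(−·)](0, x) ≤ B(x)² + A′(x)² + V(x)A(x)²` (`σ² = 1`, `V ≥ 0`). [folklore] -/
theorem energyDensity_comb_zero_le (hV0 : ∀ x, 0 ≤ V x) (hφ : ContDiff ℝ 2 (Function.uncurry φ))
    {A B : ℝ → ℝ} (hA : ∀ x, φ 0 x = A x) (hB : ∀ x, deriv (fun τ => φ τ x) 0 = B x)
    (hσ : σ ^ 2 = 1) (x : ℝ) :
    energyDensity V (fun t x => 2⁻¹ * φ t x + σ * 2⁻¹ * φ (-t) x) 0 x
      ≤ B x ^ 2 + deriv A x ^ 2 + V x * A x ^ 2 := by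
  rw [Parity.energyDensity_comb hφ]
  have hA' : φ 0 = A := funext hA
  simp only [neg_zero, hB, hA', hA]
  obtain ⟨c1, c2⟩ := coef_sq_le_one hσ
  have hVx := hV0 x
  have e1 : (2⁻¹ * B x - σ * 2⁻¹ * B x) ^ 2 ≤ B x ^ 2 := by
    rw [show 2⁻¹ * B x - σ * 2⁻¹ * B x = (2⁻¹ - σ * 2⁻¹) * B x by ring, mul_pow]
    nlinarith [sq_nonneg (B x)]
  have e2 : (2⁻¹ * deriv A x + σ * 2⁻¹ * deriv A x) ^ 2 ≤ deriv A x ^ 2 := by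
    rw [show 2⁻¹ * deriv A x + σ * 2⁻¹ * deriv A x = (2⁻¹ + σ * 2⁻¹) * deriv A x by ring, mul_pow]
    nlinarith [sq_nonneg (deriv A x)]
  have e3 : V x * (2⁻¹ * A x + σ * 2⁻¹ * A x) ^ 2 ≤ V x * A x ^ 2 := by
    rw [show 2⁻¹ * A x + σ * 2⁻¹ * A x = (2⁻¹ + σ * 2⁻¹) * A x by ring, mul_pow]
    exact mul_le_mul_of_nonneg_left (by nlinarith [sq_nonneg (A x)]) hVx
  linarith

/-- **Cutting tail data at `x = 0`**: if `A, B` vanish on the open ball `{|y| < R₀}` (`R₀ > 0`), the data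
energy densities of the left part `(1_{y<0}A, 1_{y<0}B)` and of the right part add up to that of
`(A, B)` at every point. [folklore] -/
theorem cut_density_add {A B : ℝ → ℝ} {R₀ : ℝ} (hR₀ : 0 < R₀)
    (h0 : ∀ y, |y| < R₀ → A y = 0 ∧ B y = 0) (x : ℝ) :
    ((fun y => if y < 0 then B y else 0) x ^ 2 + deriv (fun y => if y < 0 then A y else 0) x ^ 2
        + V x * (fun y => if y < 0 then A y else 0) x ^ 2)
      + ((fun y => if y < 0 then 0 else B y) x ^ 2 + deriv (fun y => if y < 0 then 0 else A y) x ^ 2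
        + V x * (fun y => if y < 0 then 0 else A y) x ^ 2)
      = B x ^ 2 + deriv A x ^ 2 + V x * A x ^ 2 := by
  rcases lt_trichotomy x 0 with hx | hx | hx
  · have hn : (fun y => if y < 0 then A y else 0) =ᶠ[𝓝 x] A := by
      filter_upwards [Iio_mem_nhds hx] with y hy using if_pos hy
    have hf : (fun y => if y < 0 then (0:ℝ) else A y) =ᶠ[𝓝 x] fun _ => 0 := by
      filter_upwards [Iio_mem_nhds hx] with y hy using if_pos hy
    rw [hn.deriv_eq, hf.deriv_eq]
    simp [if_pos hx]
  · subst hx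
    have hball : ∀ y, y ∈ Ioo (-R₀) R₀ → |y| < R₀ := fun y hy => abs_lt.2 ⟨hy.1, hy.2⟩
    have hmem : Ioo (-R₀) R₀ ∈ 𝓝 (0:ℝ) := Ioo_mem_nhds (by linarith) hR₀
    have hn : (fun y => if y < 0 then A y else 0) =ᶠ[𝓝 (0:ℝ)] fun _ => 0 := by
      filter_upwards [hmem] with y hy
      split_ifs with h1
      · exact (h0 y (hball y hy)).1
      · rfl
    have hf : (fun y => if y < 0 then (0:ℝ) else A y) =ᶠ[𝓝 (0:ℝ)] fun _ => 0 := by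
      filter_upwards [hmem] with y hy
      split_ifs with h1
      · rfl
      · exact (h0 y (hball y hy)).1
    have hA : A =ᶠ[𝓝 (0:ℝ)] fun _ => 0 := by
      filter_upwards [hmem] with y hy using (h0 y (hball y hy)).1
    obtain ⟨hA0, hB0⟩ := h0 0 (by simpa using hR₀)
    rw [hn.deriv_eq, hf.deriv_eq, hA.deriv_eq]
    simp [hA0, hB0]
  · have hn : (fun y => if y < 0 then A y else 0) =ᶠ[𝓝 x] fun _ => 0 := by
      filter_upwards [Ioi_mem_nhds hx] with y hy using if_neg (not_lt.2 (le_of_lt hy))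
    have hf : (fun y => if y < 0 then (0:ℝ) else A y) =ᶠ[𝓝 x] A := by
      filter_upwards [Ioi_mem_nhds hx] with y hy using if_neg (not_lt.2 (le_of_lt hy))
    rw [hn.deriv_eq, hf.deriv_eq]
    simp [if_neg (not_lt.2 hx.le)]

/-- The total energy of the zero solution vanishes. [folklore] -/
theorem totalEnergy_eq_zero_of_eq_zero {ψ : ℝ → ℝ → ℝ} (hψ : ∀ t x, ψ t x = 0) (t : ℝ) :
    totalEnergy V ψ t = 0 := by
  unfold totalEnergy energyDensity
  have h1 : ∀ x, (fun τ => ψ τ x) = fun _ => (0:ℝ) := fun x => funext fun τ => hψ τ x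
  have h2 : ψ t = fun _ => (0:ℝ) := funext fun y => hψ t y
  simp [h1, h2, hψ t]

end DyadicSplit

open DyadicSplit WindowedShellChannelsSplit NearHalfShare in
/-- **Stub `stub_dyadicSplit` (piece S3 of the per-mode line of `Sketch`): the large-scale split with
`(1+δ)` energy control.**  See the module docstring. [folklore in method; new] -/
theorem stub_dyadicSplit (σ : ℝ) (s ℓ : ℕ) (hsℓ : s ≤ ℓ) : ∀ ρ : ℝ, 0 < ρ → ∀ δ : ℝ, 0 < δ → ∀ R₀ : ℝ, ρ ≤ R₀ →
    ∃ R₁ : ℝ, R₀ ≤ R₁ ∧ ∀ ψ : ℝ → ℝ → ℝ, IsRWSolution 1 s ℓ (tortoiseRadius one_pos 0) ψ → (∀ t x, ψ (-t) x = σ * ψ t x) →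
      CauchyDataSupportedOn ψ {x : ℝ | ρ < |x|} → totalEnergy (linePotential 1 s ℓ (tortoiseRadius one_pos 0)) ψ 0 ≠ ⊤ →
      ∃ ψc ψn ψf : ℝ → ℝ → ℝ,
        IsRWSolution 1 s ℓ (tortoiseRadius one_pos 0) ψc ∧ IsRWSolution 1 s ℓ (tortoiseRadius one_pos 0) ψn ∧
        IsRWSolution 1 s ℓ (tortoiseRadius one_pos 0) ψf ∧
        (∀ t x, ψ t x = ψc t x + (ψn t x + ψf t x)) ∧
        (∀ t x, ψc (-t) x = σ * ψc t x) ∧ (∀ t x, ψn (-t) x = σ * ψn t x) ∧ (∀ t x, ψf (-t) x = σ * ψf t x) ∧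
        CauchyDataSupportedOn ψc (Icc (-R₁) R₁) ∧ CauchyDataSupportedOn ψn (Iio (-R₀)) ∧
        CauchyDataSupportedOn ψf (Ioi R₀) ∧
        totalEnergy (linePotential 1 s ℓ (tortoiseRadius one_pos 0)) ψc 0 ≤ ENNReal.ofReal 4 * totalEnergy (linePotential 1 s ℓ (tortoiseRadius one_pos 0)) ψ 0 ∧
        totalEnergy (linePotential 1 s ℓ (tortoiseRadius one_pos 0)) ψn 0 + totalEnergy (linePotential 1 s ℓ (tortoiseRadius one_pos 0)) ψf 0
          ≤ ENNReal.ofReal (1 + δ) * totalEnergy (linePotential 1 s ℓ (tortoiseRadius one_pos 0)) ψ 0 := by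
  intro ρ hρ δ hδ R₀ hρR₀
  set r := tortoiseRadius one_pos (0 : ℝ) with hrdef
  have hr : IsTortoiseRadius 1 r 0 := isTortoiseRadius_tortoiseRadius one_pos 0
  set V := linePotential 1 s ℓ r with hVdef
  have hVd : Differentiable ℝ V := RW.differentiable_linePotential hr s ℓ
  have hV0 : ∀ x, 0 ≤ V x := fun x => (RW.linePotential_pos hr hsℓ x).le
  have hVc : Continuous V := hVd.continuous
  have hR₀ : 0 < R₀ := lt_of_lt_of_le hρ hρR₀
  -- constants
  obtain ⟨C, hC0, hCfam⟩ := exists_logScaleCutoff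
  set δ₀ : ℝ := min δ 1 with hδ₀
  have hδ₀0 : 0 < δ₀ := lt_min hδ one_pos
  have hδ₀1 : δ₀ ≤ 1 := min_le_right _ _
  have hδ₀δ : δ₀ ≤ δ := min_le_left _ _
  set K : ℝ := 8 * C ^ 2 * (1 + 2 / δ₀) / δ₀ with hK
  have hK0 : 0 ≤ K := by positivity
  set Λ : ℝ := 1 + 2 * C + K with hΛ
  have hΛ1 : 1 ≤ Λ := by rw [hΛ]; nlinarith
  have hΛ0 : 0 < Λ := by linarith
  have hΛC : 2 * C ≤ Λ := by rw [hΛ]; linarith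
  have hΛK : K ≤ Λ ^ 2 := by nlinarith
  set R₁ : ℝ := R₀ * Real.exp Λ with hR₁
  have hexp : 1 < Real.exp Λ := by rw [← Real.exp_zero]; exact Real.exp_lt_exp.2 hΛ0
  have hR₀R₁ : R₀ < R₁ := by rw [hR₁]; nlinarith
  have hlog : Real.log (R₁ / R₀) = Λ := by
    rw [hR₁, mul_div_cancel_left₀ _ hR₀.ne', Real.log_exp]
  -- the two constant inequalities
  have hq : (C / Λ) ^ 2 ≤ 1 / 4 := by
    rw [div_pow, div_le_div_iff₀ (by positivity) (by norm_num)]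
    nlinarith
  have hconst1 : 2 + 8 * (C / Λ) ^ 2 ≤ 4 := by linarith
  have hconst2 : 1 + δ₀ / 2 + (1 + (δ₀ / 2)⁻¹) * (4 * (C / Λ) ^ 2) ≤ 1 + δ₀ := by
    have h1 : (1 + (δ₀ / 2)⁻¹) * (4 * (C / Λ) ^ 2) = (4 * C ^ 2 * (1 + 2 / δ₀)) / Λ ^ 2 := by
      field_simp
    rw [h1]
    have h2 : 4 * C ^ 2 * (1 + 2 / δ₀) / Λ ^ 2 ≤ δ₀ / 2 := by
      rw [div_le_iff₀ (by positivity)]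
      have h3 : 4 * C ^ 2 * (1 + 2 / δ₀) = K * δ₀ / 2 := by
        rw [hK]; field_simp; ring
      rw [h3]
      have := mul_le_mul_of_nonneg_left hΛK (by positivity : (0:ℝ) ≤ δ₀ / 2)
      linarith
    linarith
  refine ⟨R₁, hR₀R₁.le, ?_⟩
  intro ψ hψ hpar hsupp hfin
  have hC2 : ContDiff ℝ 2 (Function.uncurry ψ) := hψ.1
  -- degenerate parities
  by_cases hσ : σ ^ 2 = 1
  swap
  · have hz : ∀ t x, ψ t x = 0 := eq_zero_of_parity hpar hσ
    have hsupp' : ∀ S : Set ℝ, CauchyDataSupportedOn ψ S := by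
      intro S x _
      refine ⟨hz 0 x, ?_⟩
      rw [show (fun τ => ψ τ x) = fun _ => (0:ℝ) from funext fun τ => hz τ x]
      simp
    have hE0 : totalEnergy V ψ 0 = 0 := totalEnergy_eq_zero_of_eq_zero hz 0
    refine ⟨ψ, ψ, ψ, hψ, hψ, hψ, fun t x => by simp [hz], hpar, hpar, hpar, hsupp' _, hsupp' _,
      hsupp' _, ?_, ?_⟩
    · rw [hE0]; simp
    · rw [hE0]; simp
  -- the data
  set h : ℝ → ℝ := ψ 0 with hhdef
  set g : ℝ → ℝ := fun x => deriv (fun τ => ψ τ x) 0 with hgdef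
  have hhC : ContDiff ℝ 2 h := hC2.comp (contDiff_const.prodMk contDiff_id)
  have hgC : ContDiff ℝ 1 g := contDiff_one_velocityDatum hC2
  have hdata0 : ∀ x, |x| ≤ ρ → h x = 0 ∧ g x = 0 := fun x hx =>
    hsupp x (by simpa only [mem_setOf_eq, not_lt] using hx)
  -- parity of the data: `h = σh`, `−g = σg`
  have hpar0 : ∀ x, (2⁻¹ + σ * 2⁻¹) * h x = h x := by
    intro x
    have e := hpar 0 x
    rw [neg_zero] at e
    have : h x = σ * h x := e
    linear_combination (-(2⁻¹ : ℝ)) * this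
  have hpar1 : ∀ x, (2⁻¹ - σ * 2⁻¹) * g x = g x := by
    intro x
    have e1 : (fun τ => ψ (-τ) x) = fun τ => σ * ψ τ x := funext fun τ => hpar τ x
    have e2 : deriv (fun τ => ψ (-τ) x) 0 = deriv (fun τ => σ * ψ τ x) 0 := by rw [e1]
    rw [deriv_comp_neg (fun τ => ψ τ x) 0, neg_zero, deriv_const_mul_field] at e2
    have : -g x = σ * g x := e2
    linear_combination (2⁻¹ : ℝ) * this
  -- the cutoff
  obtain ⟨χ, hχC, hχ1, hχ0, hχ01, hχ'⟩ := hCfam R₀ R₁ hR₀ hR₀R₁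
  rw [hlog] at hχ'
  have hχC2 : ContDiff ℝ 2 χ := hχC.of_le (by norm_cast)
  have hχC1 : ContDiff ℝ 1 χ := hχC.of_le (by norm_cast)
  -- cut data
  set A : ℝ → ℝ := fun y => (1 - χ y) * h y with hAdef
  set B : ℝ → ℝ := fun y => (1 - χ y) * g y with hBdef
  set Ac : ℝ → ℝ := fun y => χ y * h y with hAcdef
  set Bc : ℝ → ℝ := fun y => χ y * g y with hBcdef
  have hAC : ContDiff ℝ 2 A := (contDiff_const.sub hχC2).mul hhC
  have hBC : ContDiff ℝ 1 B := (contDiff_const.sub hχC1).mul hgC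
  have hAcC : ContDiff ℝ 2 Ac := hχC2.mul hhC
  have hBcC : ContDiff ℝ 1 Bc := hχC1.mul hgC
  have hAB0 : ∀ y, |y| ≤ R₀ → A y = 0 ∧ B y = 0 := fun y hy => by
    simp only [hAdef, hBdef, hχ1 y hy, sub_self, zero_mul, and_self]
  obtain ⟨hAnC, hAfC⟩ := contDiff_cut (xc := 0) hR₀ hAC (fun y hy => (hAB0 y (by simpa using hy)).1)
  obtain ⟨hBnC, hBfC⟩ := contDiff_cut (xc := 0) hR₀ hBC (fun y hy => (hAB0 y (by simpa using hy)).2)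
  -- the three solutions and their symmetrisations
  obtain ⟨φc, hφc, hφc0, hφc1⟩ := stub_rwGlobalCauchy 1 r 0 hr s ℓ hsℓ _ _ hAcC hBcC
  obtain ⟨φn, hφn, hφn0, hφn1⟩ := stub_rwGlobalCauchy 1 r 0 hr s ℓ hsℓ _ _ hAnC hBnC
  obtain ⟨φf, hφf, hφf0, hφf1⟩ := stub_rwGlobalCauchy 1 r 0 hr s ℓ hsℓ _ _ hAfC hBfC
  set Pc : ℝ → ℝ → ℝ := fun t x => 2⁻¹ * φc t x + σ * 2⁻¹ * φc (-t) x with hPc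
  set Pn : ℝ → ℝ → ℝ := fun t x => 2⁻¹ * φn t x + σ * 2⁻¹ * φn (-t) x with hPn
  set Pf : ℝ → ℝ → ℝ := fun t x => 2⁻¹ * φf t x + σ * 2⁻¹ * φf (-t) x with hPf
  have hPcS : IsRWSolution 1 s ℓ r Pc := Parity.isSolution_comb hφc 2⁻¹ (σ * 2⁻¹)
  have hPnS : IsRWSolution 1 s ℓ r Pn := Parity.isSolution_comb hφn 2⁻¹ (σ * 2⁻¹)
  have hPfS : IsRWSolution 1 s ℓ r Pf := Parity.isSolution_comb hφf 2⁻¹ (σ * 2⁻¹)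
  -- data of the pieces
  have hPdat : ∀ (φ : ℝ → ℝ → ℝ) (A' B' : ℝ → ℝ), ContDiff ℝ 2 (Function.uncurry φ) →
      (∀ x, φ 0 x = A' x) → (∀ x, deriv (fun τ => φ τ x) 0 = B' x) →
      ∀ x, (fun t x => 2⁻¹ * φ t x + σ * 2⁻¹ * φ (-t) x) 0 x = (2⁻¹ + σ * 2⁻¹) * A' x ∧
        deriv (fun τ => (fun t x => 2⁻¹ * φ t x + σ * 2⁻¹ * φ (-t) x) τ x) 0 = (2⁻¹ - σ * 2⁻¹) * B' x := by
    intro φ A' B' hφ hA hB x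
    constructor
    · show 2⁻¹ * φ 0 x + σ * 2⁻¹ * φ (-0) x = _
      rw [neg_zero, hA]; ring
    · show deriv (fun τ => 2⁻¹ * φ τ x + σ * 2⁻¹ * φ (-τ) x) 0 = _
      rw [Parity.deriv_comb_fst hφ, neg_zero, hB]; ring
  have hdc : ∀ x, Pc 0 x = (2⁻¹ + σ * 2⁻¹) * Ac x ∧
      deriv (fun τ => Pc τ x) 0 = (2⁻¹ - σ * 2⁻¹) * Bc x := hPdat φc Ac Bc hφc.1 hφc0 hφc1
  have hdn : ∀ x, Pn 0 x = (2⁻¹ + σ * 2⁻¹) * (fun y => if y < 0 then A y else 0) x ∧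
      deriv (fun τ => Pn τ x) 0 = (2⁻¹ - σ * 2⁻¹) * (fun y => if y < 0 then B y else 0) x :=
    hPdat φn _ _ hφn.1 hφn0 hφn1
  have hdf : ∀ x, Pf 0 x = (2⁻¹ + σ * 2⁻¹) * (fun y => if y < 0 then 0 else A y) x ∧
      deriv (fun τ => Pf τ x) 0 = (2⁻¹ - σ * 2⁻¹) * (fun y => if y < 0 then 0 else B y) x :=
    hPdat φf _ _ hφf.1 hφf0 hφf1
  -- supports of the un-symmetrised solutions
  have hsc : CauchyDataSupportedOn φc (Icc (-R₁) R₁) := by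
    intro x hx
    have hx' : R₁ ≤ |x| := by
      simp only [mem_Icc, not_and_or, not_le] at hx
      rcases hx with h1 | h1
      · rw [abs_of_neg (by linarith)]; linarith
      · rw [abs_of_pos (by linarith)]; linarith
    rw [hφc0, hφc1]
    simp only [hAcdef, hBcdef, hχ0 x hx', zero_mul, and_self]
  have hsn : CauchyDataSupportedOn φn (Iio (-R₀)) := by
    intro x hx
    have hx' : -R₀ ≤ x := not_lt.1 hx
    rw [hφn0, hφn1]
    by_cases h1 : x < 0
    · have hab := hAB0 x (by rw [abs_of_neg h1]; linarith)
      simp only [if_pos h1, hab, and_self]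
    · simp only [if_neg h1, and_self]
  have hsf : CauchyDataSupportedOn φf (Ioi R₀) := by
    intro x hx
    have hx' : x ≤ R₀ := not_lt.1 hx
    rw [hφf0, hφf1]
    by_cases h1 : x < 0
    · simp only [if_pos h1, and_self]
    · have hab := hAB0 x (by rw [abs_of_nonneg (not_lt.1 h1)]; exact hx')
      simp only [if_neg h1, hab, and_self]
  refine ⟨Pc, Pn, Pf, hPcS, hPnS, hPfS, ?_, comb_parity hσ, comb_parity hσ, comb_parity hσ,
    Parity.supported_comb hφc.1 hsc _ _, Parity.supported_comb hφn.1 hsn _ _,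
    Parity.supported_comb hφf.1 hsf _ _, ?_, ?_⟩
  · -- the decomposition, by uniqueness
    set S : ℝ → ℝ → ℝ := fun t x => Pc t x + (Pn t x + Pf t x) with hS
    have hSsol : IsRWSolution 1 s ℓ r S := by
      have h1 := isSolution_lincomb hPcS (isSolution_lincomb hPnS hPfS 1 1) 1 1
      have e : (fun t x => 1 * Pc t x + 1 * (fun t x => 1 * Pn t x + 1 * Pf t x) t x) = S := by
        funext t x; simp only [hS, one_mul]
      rw [e] at h1; exact h1
    have hdP : ∀ (φ : ℝ → ℝ → ℝ), ContDiff ℝ 2 (Function.uncurry φ) → ∀ x,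
        DifferentiableAt ℝ (fun τ => (fun t x => 2⁻¹ * φ t x + σ * 2⁻¹ * φ (-t) x) τ x) 0 :=
      fun φ hφ x => ((Parity.contDiff_uncurry_comb hφ 2⁻¹ (σ * 2⁻¹)).comp
        (contDiff_id.prodMk contDiff_const)).differentiable (by norm_num) 0
    have hdPc : ∀ x, DifferentiableAt ℝ (fun τ => Pc τ x) 0 := hdP φc hφc.1
    have hdPn : ∀ x, DifferentiableAt ℝ (fun τ => Pn τ x) 0 := hdP φn hφn.1
    have hdPf : ∀ x, DifferentiableAt ℝ (fun τ => Pf τ x) 0 := hdP φf hφf.1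
    have hdPnf : ∀ x, DifferentiableAt ℝ (fun τ => Pn τ x + Pf τ x) 0 := fun x =>
      (hdPn x).add (hdPf x)
    have key : ψ = S := by
      refine solution_unique hVd hV0 hψ hSsol (fun x => ?_) (fun x => ?_)
      · show ψ 0 x = Pc 0 x + (Pn 0 x + Pf 0 x)
        rw [(hdc x).1, (hdn x).1, (hdf x).1]
        have hsum : Ac x + ((if x < 0 then A x else 0) + (if x < 0 then 0 else A x)) = h x := by
          simp only [hAcdef, hAdef]; split_ifs <;> ring
        calc ψ 0 x = h x := rfl
          _ = (2⁻¹ + σ * 2⁻¹) * h x := (hpar0 x).symm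
          _ = _ := by rw [← hsum]; ring
      · show deriv (fun τ => ψ τ x) 0 = deriv (fun τ => Pc τ x + (Pn τ x + Pf τ x)) 0
        rw [deriv_fun_add (hdPc x) (hdPnf x), deriv_fun_add (hdPn x) (hdPf x), (hdc x).2, (hdn x).2,
          (hdf x).2]
        have hsum : Bc x + ((if x < 0 then B x else 0) + (if x < 0 then 0 else B x)) = g x := by
          simp only [hBcdef, hBdef]; split_ifs <;> ring
        calc deriv (fun τ => ψ τ x) 0 = g x := rfl
          _ = (2⁻¹ - σ * 2⁻¹) * g x := (hpar1 x).symm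
          _ = _ := by rw [← hsum]; ring
    intro t x
    exact congrFun (congrFun key t) x
  · -- energy of the compact piece
    have h1 : totalEnergy V Pc 0 ≤ ∫⁻ x, ENNReal.ofReal (Bc x ^ 2 + deriv Ac x ^ 2 + V x * Ac x ^ 2) := by
      unfold totalEnergy
      exact lintegral_mono fun x => ENNReal.ofReal_le_ofReal
        (energyDensity_comb_zero_le hV0 hφc.1 hφc0 hφc1 hσ x)
    have h2 := lintegral_cutData_le (V := V) (g := g) hVc hV0 (hhC.of_le (by norm_num)) hgC.continuous
      hχC1 hχ01 hρ hΛ0 (fun x hx => (hdata0 x hx).1) hχ'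
    have hE : totalEnergy V ψ 0 = ∫⁻ x, ENNReal.ofReal (g x ^ 2 + deriv h x ^ 2 + V x * h x ^ 2) := by
      unfold totalEnergy energyDensity; rfl
    rw [hE]
    refine h1.trans (h2.trans ?_)
    exact mul_le_mul_of_nonneg_right (ENNReal.ofReal_le_ofReal hconst1) bot_le
  · -- energy of the near and far pieces
    have h1 : totalEnergy V Pn 0 ≤ ∫⁻ x, ENNReal.ofReal ((fun y => if y < 0 then B y else 0) x ^ 2
        + deriv (fun y => if y < 0 then A y else 0) x ^ 2 + V x * (fun y => if y < 0 then A y else 0) x ^ 2) := by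
      unfold totalEnergy
      exact lintegral_mono fun x => ENNReal.ofReal_le_ofReal
        (energyDensity_comb_zero_le hV0 hφn.1 hφn0 hφn1 hσ x)
    have h2 : totalEnergy V Pf 0 ≤ ∫⁻ x, ENNReal.ofReal ((fun y => if y < 0 then 0 else B y) x ^ 2
        + deriv (fun y => if y < 0 then 0 else A y) x ^ 2 + V x * (fun y => if y < 0 then 0 else A y) x ^ 2) := by
      unfold totalEnergy
      exact lintegral_mono fun x => ENNReal.ofReal_le_ofReal
        (energyDensity_comb_zero_le hV0 hφf.1 hφf0 hφf1 hσ x)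
    have hAB0' : ∀ y, |y| < R₀ → A y = 0 ∧ B y = 0 := fun y hy => hAB0 y hy.le
    have hmeas : Measurable fun x => ENNReal.ofReal ((fun y => if y < 0 then B y else 0) x ^ 2
        + deriv (fun y => if y < 0 then A y else 0) x ^ 2 + V x * (fun y => if y < 0 then A y else 0) x ^ 2) := by
      refine Measurable.ennreal_ofReal ?_
      exact (((hBnC.continuous.pow 2).add ((hAnC.continuous_deriv (by norm_num)).pow 2)).add
        (hVc.mul (hAnC.continuous.pow 2))).measurable
    have h3 : totalEnergy V Pn 0 + totalEnergy V Pf 0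
        ≤ ∫⁻ x, ENNReal.ofReal (B x ^ 2 + deriv A x ^ 2 + V x * A x ^ 2) := by
      refine (add_le_add h1 h2).trans (le_of_eq ?_)
      rw [← lintegral_add_left hmeas]
      refine lintegral_congr fun x => ?_
      rw [← ENNReal.ofReal_add (by have := hV0 x; positivity) (by have := hV0 x; positivity),
        cut_density_add (V := V) hR₀ hAB0' x]
    have h4 := lintegral_tailData_le (V := V) (g := g) hVc hV0 (hhC.of_le (by norm_num)) hgC.continuous
      hχC1 hχ01 hρ hΛ0 (fun x hx => (hdata0 x hx).1) hχ' (η := δ₀ / 2) (by positivity)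
    have hE : totalEnergy V ψ 0 = ∫⁻ x, ENNReal.ofReal (g x ^ 2 + deriv h x ^ 2 + V x * h x ^ 2) := by
      unfold totalEnergy energyDensity; rfl
    rw [hE]
    refine h3.trans (h4.trans ?_)
    have hc : 1 + δ₀ / 2 + (1 + (δ₀ / 2)⁻¹) * (4 * (C / Λ) ^ 2) ≤ 1 + δ := hconst2.trans (by linarith)
    exact mul_le_mul_of_nonneg_right (ENNReal.ofReal_le_ofReal hc) bot_le

end Summit.FinalStateConjecture.FinalStateConjecture.Theorems.WindowedShellChannelsSketch

end
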